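import Mathlib
import Literature.Analysis.Calculus.CollectivelyCompactApproximation
import Summits.NavierStokesRegularity.FluidComputer.CertifierNormBounds

/-!
# The bordered operator of THEOREM 3-B in resolvent coordinates: bijectivity by the Fredholm alternative, the inverse bound from an a-priori estimate, and the a-priori estimate from head/tail data (profile-cert-3 g4, cell `ns-blowup`, 2026-08-26)

HONEST FRAMING (human rulings D-0035/D-0074): nothing here is a claim about Navier–Stokes blow-up.
WHAT THIS IS NOT: not NS evidence. These are abstract Hilbert-space / Banach-algebra theorems. Their
consumer is conclusion (a) of THEOREM 3-B of `instab/CERT-ROPE-X0.md` (REFEREE A19 PASS) — «the bordered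
operator `𝔅(w, μ) = ((λ̃ − L)w + μṽ, ⟨w, ṽ⟩)` is a bijection `(H² ∩ H) × ℂ → Ĥ` with `‖𝔅⁻¹‖ ≤ M`» —
for the MODEL operator `L` (forced NS linearised about abc(1,1,1), a symmetry class), which the F5
certificate rows of GROUP B (`CertificateAbcSpectrum*`, three implementations) and their kernel chain
(`CertifierNormBounds`, `…Chain*`) consume through `BorderedEigenpairFixedPoint` (K-B4: «a bounded
linear `S = 𝔅⁻¹∘ι` with `‖S‖ ≤ M`»). Until now this step was the standing paper-grade caveat (ii) of
the CR chain-rigour column («Lax–Milgram on the Fourier tail + compact resolvent»).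

SETTING (the RESOLVENT COORDINATES of instab4's `SkewCutGalerkinPerturbation` / `…Injectivity`): the
unbounded `L = L₀ + A` is presented through the free resolvent `S₀ = (x₀ − L₀)⁻¹` (compact, injective)
and the relative bound `T = A S₀` (`1 − T` invertible): `D(L) = range S₀` and
`(a − L)(S₀ w) = R_a w`, `R_a := 1 − T − (x₀ − a) S₀` — a BOUNDED operator on `H`. In these
coordinates the bordered operator is the bounded map `𝔅′(w, μ) = (R w + μṽ, ⟪ṽ, S₀ w⟫)` on the
`ℓ²`-product `H ⊕₂ 𝕜 = WithLp 2 (H × 𝕜)`, and «`‖𝔅⁻¹‖ ≤ M`» reads: every datum `f̂` has exactly one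
preimage `(w, μ)`, and `‖(S₀ w, μ)‖ ≤ M‖f̂‖` (the unknown is measured by `v = S₀ w`, as in 3-B).

* §1 `isUnit_of_isUnit_add_compact_of_injective` — unit + compact, injective ⇒ unit (Riesz theory,
  via the tree's `Literature.Analysis.Calculus.riesz_isUnit_one_sub`, itself Mathlib's Fredholm
  alternative `IsCompactOperator.hasEigenvalue_or_mem_resolventSet`); `isUnit_resolventCoord_of_injective`
  — `R_z` injective ⇒ `R_z` invertible: in resolvent coordinates «`z` is not an eigenvalue of `L`» already
  gives «`z ∈ ρ(L)`», the PURE-POINT-SPECTRUM fact used in 3-B (d) (`σ(L) ∩ disc = {λ⋆}`).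
* §2 `exists_borderedCLM` (the bordered map IS a bounded operator on `H ⊕₂ 𝕜`, with its formula),
  `isUnit_bordered_of_injective` (it is «unit ⊕ unit + compact», so injective ⇒ invertible),
  `bordered_inverse_of_apriori` / `bordered_resolventCoord_inverse` — an A-PRIORI BOUND
  `‖(S₀ w, μ)‖ ≤ M‖𝔅′(w, μ)‖` gives a two-sided inverse `Binv` and a bounded `S = (S₀ ⊕ 1)∘Binv` with
  `‖S‖ ≤ M`: 3-B (a) with the Lax–Milgram EXISTENCE step replaced by Fredholm index zero.
* §3 `apriori_bound_of_head_tail` — the a-priori bound itself, 3-B (a) STEPS 2–3 read as an ESTIMATE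
  (no existence needed): split `H = U ⊕ Uᗮ` (head = cube truncation, `ṽ ∈ U`, `S₀` preserving both), a
  LINEAR left inverse `Ainv` of the bordered head `(u, μ) ↦ (P R u + μṽ, φ u)` with the three printed
  constants `α ≥ ‖Â⁻¹‖`, `β_B ≥ ‖Â⁻¹B̂‖`, `β_C ≥ ‖ĈÂ⁻¹‖` (in the `v = S₀ w` measure) and the tail
  Schur coercivity `μ‖S₀w‖² ≤ Re⟪R w − R (Ainv(P R w, 0)).1, S₀ w⟫` on `Uᗮ` (the certified `MU2_b > 0`,
  shape of `SkewCutGalerkinInjectivity.injective_of_head_tail_coercive` / `SkewCutGalerkinTailForm`) give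
  `‖(S₀ w, μ)‖ ≤ M₀‖(R w + μṽ, φ w)‖` with `M₀ = √((1 + β_C²)/μ² + (α + β_B√(1 + β_C²)/μ)²)` — EXACTLY the
  printed `M₀` of every row (`CertifierNormBounds.WithLp.norm_le_backSubst_mul_norm`).
* §4 `bordered_inverse_of_head_tail` — §3 + §2 composed for `R = 1 − T − c S₀`, `φ = ⟪ṽ, S₀ ·⟫`.

After this file the non-kernel part of a 3-B row's conclusion (a) is model ASSEMBLY only (that the
certifier's matrices are the head blocks of THIS `R`, the pairing/shell facts feeding the coercivity —
instab4 `KERNEL-CHAIN.md` §2 (A1)–(A4)) plus each program's outward-rounding claim. Mathlib + the two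
files named; no new definitions. bears_on LADDER-NS N5 / Z4-a(1)(2) (F5 certificate rigour);
evidence-only for route item `EpisodeBase` (stmt-NavierStokesRegularity-19179).
-/

open scoped InnerProductSpace

namespace Summit.NavierStokesRegularity.FluidComputer.BorderedResolventFredholm

/-! ## §1 Unit + compact: injective ⇒ invertible (Riesz / Fredholm alternative) -/

section Fredholm

variable {𝕜 X : Type*} [NontriviallyNormedField 𝕜] [NormedAddCommGroup X] [NormedSpace 𝕜 X]
  [CompleteSpace X]

/-- **Unit plus compact, injective ⇒ unit.** On a Banach space, if `E` is invertible, `K` is a compact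
operator and `E + K` is injective, then `E + K` is invertible (a unit of `X →L X`, hence bijective
with bounded inverse): `E + K = E(1 − (−E⁻¹K))` and Riesz's theorem
(`Literature.Analysis.Calculus.riesz_isUnit_one_sub`, from Mathlib's Fredholm alternative) applies to
the compact `−E⁻¹K`. [folklore] -/
theorem isUnit_of_isUnit_add_compact_of_injective (E K : X →L[𝕜] X) (hE : IsUnit E)
    (hK : IsCompactOperator K) (hinj : Function.Injective (E + K)) : IsUnit (E + K) := by
  obtain ⟨u, rfl⟩ := hE
  set K' : X →L[𝕜] X := -((↑u⁻¹ : X →L[𝕜] X) * K) with hK'def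
  have hK'c : IsCompactOperator K' := (hK.clm_comp (↑u⁻¹ : X →L[𝕜] X)).neg
  have hfac : (↑u : X →L[𝕜] X) + K = ↑u * (1 - K') := by
    rw [hK'def, sub_neg_eq_add, mul_add, mul_one, ← mul_assoc, Units.mul_inv, one_mul]
  have hinj' : ∀ x : X, (1 - K') x = 0 → x = 0 := by
    intro x hx
    apply hinj
    simp only [hfac, ContinuousLinearMap.mul_def, ContinuousLinearMap.comp_apply, hx, map_zero]
  rw [hfac]
  exact (Units.isUnit u).mul (Literature.Analysis.Calculus.riesz_isUnit_one_sub K' hK'c hinj')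

/-- **Pure point spectrum in resolvent coordinates.** With `S₀` compact (the free resolvent
`(x₀ − L₀)⁻¹`, Rellich) and `1 − T` invertible (`T = A S₀`, `‖T‖ < 1` by the Schur sums), the
operator `R_z = 1 − T − c•S₀` (`c = x₀ − z`; `(z − L)(S₀ w) = R_z w`) is invertible as soon as it is
injective. Reading: if `z` is not an eigenvalue of the MODEL operator `L` then `z − L : D(L) → H` is a
bijection with bounded `S₀ R_z⁻¹` — the compact-resolvent fact «`σ(L)` is pure point spectrum» used in
3-B (d). [folklore] -/
theorem isUnit_resolventCoord_of_injective (S₀ T : X →L[𝕜] X) (hS₀ : IsCompactOperator S₀)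
    (hT : IsUnit ((1 : X →L[𝕜] X) - T)) (c : 𝕜)
    (hinj : Function.Injective ((1 : X →L[𝕜] X) - T - c • S₀)) :
    IsUnit ((1 : X →L[𝕜] X) - T - c • S₀) := by
  have hK : IsCompactOperator ((-c) • S₀ : X →L[𝕜] X) := hS₀.smul (-c)
  have heq : (1 : X →L[𝕜] X) - T - c • S₀ = ((1 : X →L[𝕜] X) - T) + (-c) • S₀ := by
    rw [neg_smul, sub_eq_add_neg]
  rw [heq] at hinj ⊢
  exact isUnit_of_isUnit_add_compact_of_injective _ _ hT hK hinj

/-- Bijective form of `isUnit_resolventCoord_of_injective`: `R_z` injective ⇒ `R_z` bijective, i.e.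
for every `f ∈ H` there is exactly one `w` with `(z − L)(S₀ w) = f`. [folklore] -/
theorem bijective_resolventCoord_of_injective (S₀ T : X →L[𝕜] X) (hS₀ : IsCompactOperator S₀)
    (hT : IsUnit ((1 : X →L[𝕜] X) - T)) (c : 𝕜)
    (hinj : Function.Injective ((1 : X →L[𝕜] X) - T - c • S₀)) :
    Function.Bijective ((1 : X →L[𝕜] X) - T - c • S₀) :=
  ContinuousLinearMap.isUnit_iff_bijective.mp (isUnit_resolventCoord_of_injective S₀ T hS₀ hT c hinj)

end Fredholm

/-! ## §2 The bordered operator on `H ⊕₂ 𝕜`: bounded, «unit + compact», inverse bound -/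

section Bordered

variable {𝕜 H : Type*} [RCLike 𝕜] [NormedAddCommGroup H] [InnerProductSpace 𝕜 H]

/-- **The bordered map is a bounded operator on `H ⊕₂ 𝕜`.** For bounded `R`, a vector `v` and a
bounded functional `φ` there is a continuous linear `B` on `WithLp 2 (H × 𝕜)` with
`B (w, μ) = (R w + μ • v, φ w)` (in 3-B: `R = λ̃ − L` in resolvent coordinates, `v = ṽ`,
`φ = ⟪ṽ, S₀ ·⟫`). No definition is introduced; consumers obtain `B` from this existential. [folklore] -/
theorem exists_borderedCLM (R : H →L[𝕜] H) (v : H) (φ : H →L[𝕜] 𝕜) :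
    ∃ B : WithLp 2 (H × 𝕜) →L[𝕜] WithLp 2 (H × 𝕜),
      ∀ w μ, B (WithLp.toLp 2 (w, μ)) = WithLp.toLp 2 (R w + μ • v, φ w) := by
  let P := WithLp.prodContinuousLinearEquiv 2 𝕜 H 𝕜
  refine ⟨(P.symm : H × 𝕜 →L[𝕜] WithLp 2 (H × 𝕜)) ∘L
    ((R ∘L ContinuousLinearMap.fst 𝕜 H 𝕜 +
      (ContinuousLinearMap.toSpanSingleton 𝕜 v) ∘L ContinuousLinearMap.snd 𝕜 H 𝕜).prod
      (φ ∘L ContinuousLinearMap.fst 𝕜 H 𝕜)) ∘L (P : WithLp 2 (H × 𝕜) →L[𝕜] H × 𝕜), fun w μ => ?_⟩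
  simp [P, ContinuousLinearMap.toSpanSingleton_apply]

/-- Two continuous linear maps out of `H ⊕₂ 𝕜` that agree on every `(w, μ)` are equal. [folklore] -/
theorem clm_eq_of_forall_toLp_eq {Y : Type*} [TopologicalSpace Y] [AddCommMonoid Y] [Module 𝕜 Y]
    (B C : WithLp 2 (H × 𝕜) →L[𝕜] Y)
    (h : ∀ w μ, B (WithLp.toLp 2 (w, μ)) = C (WithLp.toLp 2 (w, μ))) : B = C := by
  refine ContinuousLinearMap.ext fun x => ?_
  obtain ⟨⟨w, μ⟩⟩ := x
  exact h w μ

variable [CompleteSpace H]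

/-- **The bordered operator is «unit ⊕ unit + compact»; injective ⇒ invertible.** If
`B (w, μ) = ((E + K) w + μ • v, φ w)` with `E` invertible and `K` compact (in 3-B: `E = 1 − T`,
`K = −(x₀ − λ̃) S₀`), then `B = Ê + K̂` with `Ê (w, μ) = (E w, μ)` invertible and
`K̂ (w, μ) = (K w + μ • v, φ w − μ)` compact (compact plus finite rank), so §1 applies: `B`
injective ⇒ `B` is a unit of `H ⊕₂ 𝕜 →L H ⊕₂ 𝕜`. [folklore] -/
theorem isUnit_bordered_of_injective (E K : H →L[𝕜] H) (hE : IsUnit E)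
    (hK : IsCompactOperator K) (v : H) (φ : H →L[𝕜] 𝕜)
    (B : WithLp 2 (H × 𝕜) →L[𝕜] WithLp 2 (H × 𝕜))
    (hB : ∀ w μ, B (WithLp.toLp 2 (w, μ)) = WithLp.toLp 2 ((E + K) w + μ • v, φ w))
    (hinj : Function.Injective B) : IsUnit B := by
  obtain ⟨u, rfl⟩ := hE
  let P := WithLp.prodContinuousLinearEquiv 2 𝕜 H 𝕜
  let Pf : WithLp 2 (H × 𝕜) →L[𝕜] H × 𝕜 := P
  let Pb : H × 𝕜 →L[𝕜] WithLp 2 (H × 𝕜) := P.symm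
  -- the block-diagonal unit `Ê (w, μ) = (E w, μ)` and its inverse
  let Eh : WithLp 2 (H × 𝕜) →L[𝕜] WithLp 2 (H × 𝕜) :=
    Pb ∘L ((↑u : H →L[𝕜] H).prodMap (ContinuousLinearMap.id 𝕜 𝕜)) ∘L Pf
  let Ei : WithLp 2 (H × 𝕜) →L[𝕜] WithLp 2 (H × 𝕜) :=
    Pb ∘L ((↑u⁻¹ : H →L[𝕜] H).prodMap (ContinuousLinearMap.id 𝕜 𝕜)) ∘L Pf
  have hEh : ∀ w μ, Eh (WithLp.toLp 2 (w, μ)) = WithLp.toLp 2 ((↑u : H →L[𝕜] H) w, μ) := by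
    intro w μ; simp [Eh, Pb, Pf, P]
  have hEi : ∀ w μ, Ei (WithLp.toLp 2 (w, μ)) = WithLp.toLp 2 ((↑u⁻¹ : H →L[𝕜] H) w, μ) := by
    intro w μ; simp [Ei, Pb, Pf, P]
  have huu : ∀ w, (↑u : H →L[𝕜] H) ((↑u⁻¹ : H →L[𝕜] H) w) = w := fun w => by
    rw [← ContinuousLinearMap.comp_apply, ← ContinuousLinearMap.mul_def, Units.mul_inv]; rfl
  have huu' : ∀ w, (↑u⁻¹ : H →L[𝕜] H) ((↑u : H →L[𝕜] H) w) = w := fun w => by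
    rw [← ContinuousLinearMap.comp_apply, ← ContinuousLinearMap.mul_def, Units.inv_mul]; rfl
  have hunit : IsUnit Eh := by
    refine ⟨⟨Eh, Ei, ?_, ?_⟩, rfl⟩
    · refine clm_eq_of_forall_toLp_eq _ _ fun w μ => ?_
      rw [ContinuousLinearMap.mul_def, ContinuousLinearMap.comp_apply, hEi, hEh, huu]; rfl
    · refine clm_eq_of_forall_toLp_eq _ _ fun w μ => ?_
      rw [ContinuousLinearMap.mul_def, ContinuousLinearMap.comp_apply, hEh, hEi, huu']; rfl
  -- the compact remainder `K̂ (w, μ) = (K w + μ v, φ w − μ)`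
  let inlX : H →L[𝕜] WithLp 2 (H × 𝕜) := Pb ∘L ContinuousLinearMap.inl 𝕜 H 𝕜
  let inrX : 𝕜 →L[𝕜] WithLp 2 (H × 𝕜) := Pb ∘L ContinuousLinearMap.inr 𝕜 H 𝕜
  let fstX : WithLp 2 (H × 𝕜) →L[𝕜] H := ContinuousLinearMap.fst 𝕜 H 𝕜 ∘L Pf
  let sndX : WithLp 2 (H × 𝕜) →L[𝕜] 𝕜 := ContinuousLinearMap.snd 𝕜 H 𝕜 ∘L Pf
  let Kh : WithLp 2 (H × 𝕜) →L[𝕜] WithLp 2 (H × 𝕜) :=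
    inlX ∘L K ∘L fstX + inlX ∘L (ContinuousLinearMap.toSpanSingleton 𝕜 v) ∘L sndX
      + inrX ∘L φ ∘L fstX - inrX ∘L sndX
  have hKh : ∀ w μ, Kh (WithLp.toLp 2 (w, μ)) = WithLp.toLp 2 (K w + μ • v, φ w - μ) := by
    intro w μ
    simp [Kh, inlX, inrX, fstX, sndX, Pb, Pf, P, ContinuousLinearMap.toSpanSingleton_apply]
    rw [← WithLp.toLp_smul, ← WithLp.toLp_add, ← WithLp.toLp_add, ← WithLp.toLp_sub]
    simp
  have hKc : IsCompactOperator Kh := by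
    have h1 : IsCompactOperator (inlX ∘L K ∘L fstX) := (hK.comp_clm fstX).clm_comp inlX
    have hs : IsCompactOperator sndX := isCompactOperator_of_locallyCompactSpace_dom sndX
    have h2 : IsCompactOperator (inlX ∘L (ContinuousLinearMap.toSpanSingleton 𝕜 v) ∘L sndX) :=
      hs.clm_comp (inlX ∘L ContinuousLinearMap.toSpanSingleton 𝕜 v)
    have h3 : IsCompactOperator (inrX ∘L φ ∘L fstX) :=
      (isCompactOperator_of_locallyCompactSpace_dom (φ ∘L fstX)).clm_comp inrX
    have h4 : IsCompactOperator (inrX ∘L sndX) := hs.clm_comp inrX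
    exact ((h1.add h2).add h3).sub h4
  have hdec : B = Eh + Kh := by
    refine clm_eq_of_forall_toLp_eq _ _ fun w μ => ?_
    rw [hB]
    change _ = Eh (WithLp.toLp 2 (w, μ)) + Kh (WithLp.toLp 2 (w, μ))
    rw [hEh, hKh, ← WithLp.toLp_add, Prod.mk_add_mk]
    congr 1; ext
    · exact add_assoc _ _ _
    · simp
  rw [hdec] at hinj ⊢
  exact isUnit_of_isUnit_add_compact_of_injective Eh Kh hunit hKc hinj

/-- **3-B (a), existence half: from the a-priori bound to the bounded inverse.** Let
`B (w, μ) = ((E + K) w + μ • v, φ w)` on `H ⊕₂ 𝕜` with `E` invertible, `K` compact, `S₀` injective,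
and suppose the A-PRIORI BOUND `‖(S₀ w, μ)‖ ≤ M‖B (w, μ)‖` for all `(w, μ)` (§3 derives it from the
certificate's head/tail data). Then `B` has a two-sided continuous linear inverse `Binv`, and the map
`S := (S₀ ⊕ 1) ∘ Binv` — which sends a datum `f̂` to the solution `x = (v, μ) = (S₀ w, μ)` of the
bordered equation, i.e. `𝔅⁻¹` of 3-B measured as 3-B measures it — is a bounded operator with
`‖S‖ ≤ M`: exactly the `S`, `‖S‖ ≤ M` consumed by
`BorderedEigenpairFixedPoint.existsUnique_fixedPoint_of_kappa_lt_one` (K-B4). [folklore] -/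
theorem bordered_inverse_of_apriori (E K S₀ : H →L[𝕜] H) (hE : IsUnit E)
    (hK : IsCompactOperator K) (hS₀ : Function.Injective S₀) (v : H) (φ : H →L[𝕜] 𝕜)
    (B : WithLp 2 (H × 𝕜) →L[𝕜] WithLp 2 (H × 𝕜))
    (hB : ∀ w μ, B (WithLp.toLp 2 (w, μ)) = WithLp.toLp 2 ((E + K) w + μ • v, φ w))
    {M : ℝ} (hM : 0 ≤ M)
    (hapr : ∀ w μ, ‖WithLp.toLp 2 (S₀ w, μ)‖ ≤ M * ‖B (WithLp.toLp 2 (w, μ))‖) :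
    ∃ Binv : WithLp 2 (H × 𝕜) →L[𝕜] WithLp 2 (H × 𝕜),
      (∀ x, B (Binv x) = x) ∧ (∀ x, Binv (B x) = x) ∧
      ∃ S : WithLp 2 (H × 𝕜) →L[𝕜] WithLp 2 (H × 𝕜), ‖S‖ ≤ M ∧
        ∀ x, S x = WithLp.toLp 2 (S₀ (Binv x).fst, (Binv x).snd) := by
  -- injectivity from the a-priori bound
  have hinj : Function.Injective B := by
    intro x y hxy
    obtain ⟨⟨w, μ⟩⟩ := x
    obtain ⟨⟨w', μ'⟩⟩ := y
    have h0 : B (WithLp.toLp 2 (w - w', μ - μ')) = 0 := by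
      rw [← Prod.mk_sub_mk, WithLp.toLp_sub, map_sub, hxy, sub_self]
    have h1 := hapr (w - w') (μ - μ')
    rw [h0, norm_zero, mul_zero] at h1
    have h2 : WithLp.toLp 2 (S₀ (w - w'), μ - μ') = 0 := norm_le_zero_iff.mp h1
    have h3 : S₀ (w - w') = 0 ∧ μ - μ' = 0 := by
      have := congrArg WithLp.ofLp h2
      simpa [Prod.ext_iff] using this
    have hw : w = w' := sub_eq_zero.mp (hS₀ (by rw [h3.1, map_zero]))
    have hμ : μ = μ' := sub_eq_zero.mp h3.2
    rw [hw, hμ]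
  obtain ⟨u, hu⟩ := isUnit_bordered_of_injective E K hE hK v φ B hB hinj
  let P := WithLp.prodContinuousLinearEquiv 2 𝕜 H 𝕜
  let J : WithLp 2 (H × 𝕜) →L[𝕜] WithLp 2 (H × 𝕜) :=
    (P.symm : H × 𝕜 →L[𝕜] WithLp 2 (H × 𝕜)) ∘L (S₀.prodMap (ContinuousLinearMap.id 𝕜 𝕜)) ∘L
      (P : WithLp 2 (H × 𝕜) →L[𝕜] H × 𝕜)
  have hJ : ∀ x, J x = WithLp.toLp 2 (S₀ x.fst, x.snd) := by
    intro x; obtain ⟨⟨w, μ⟩⟩ := x; simp [J, P]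
  set Bi : WithLp 2 (H × 𝕜) →L[𝕜] WithLp 2 (H × 𝕜) := ↑u⁻¹ with hBi
  have hBu : ∀ x, B (Bi x) = x := fun x => by
    rw [← hu, hBi, ← ContinuousLinearMap.comp_apply, ← ContinuousLinearMap.mul_def, Units.mul_inv]
    rfl
  have huB : ∀ x, Bi (B x) = x := fun x => by
    rw [← hu, hBi, ← ContinuousLinearMap.comp_apply, ← ContinuousLinearMap.mul_def, Units.inv_mul]
    rfl
  refine ⟨Bi, hBu, huB, J ∘L Bi, ?_, fun x => by rw [ContinuousLinearMap.comp_apply, hJ]⟩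
  refine ContinuousLinearMap.opNorm_le_bound _ hM fun x => ?_
  rw [ContinuousLinearMap.comp_apply, hJ]
  have hy' : WithLp.toLp 2 ((Bi x).fst, (Bi x).snd) = Bi x := rfl
  calc ‖WithLp.toLp 2 (S₀ (Bi x).fst, (Bi x).snd)‖
      ≤ M * ‖B (WithLp.toLp 2 ((Bi x).fst, (Bi x).snd))‖ := hapr _ _
    _ = M * ‖x‖ := by rw [hy', hBu]

/-- **3-B (a), existence half, in resolvent coordinates.** The specialisation of
`bordered_inverse_of_apriori` to `R = 1 − T − c•S₀` (`c = x₀ − λ̃`), `φ = ⟪ṽ, S₀ ·⟫`, with `S₀`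
compact and injective and `1 − T` invertible: the a-priori bound `‖(S₀ w, μ)‖ ≤ M‖𝔅′(w, μ)‖` makes the
bordered operator `𝔅′(w, μ) = (R w + μ ṽ, ⟪ṽ, S₀ w⟫)` bijective with `‖(S₀ ⊕ 1)𝔅′⁻¹‖ ≤ M` — i.e. 3-B's
`𝔅 : (D(L) × ℂ) → Ĥ` is a bijection with `‖𝔅⁻¹‖ ≤ M`, WITHOUT a Lax–Milgram step. [folklore] -/
theorem bordered_resolventCoord_inverse (S₀ T : H →L[𝕜] H) (hS₀c : IsCompactOperator S₀)
    (hS₀ : Function.Injective S₀) (hT : IsUnit ((1 : H →L[𝕜] H) - T)) (c : 𝕜) (v : H)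
    (B : WithLp 2 (H × 𝕜) →L[𝕜] WithLp 2 (H × 𝕜))
    (hB : ∀ w μ, B (WithLp.toLp 2 (w, μ)) =
      WithLp.toLp 2 (((1 : H →L[𝕜] H) - T - c • S₀) w + μ • v, ⟪v, S₀ w⟫_𝕜))
    {M : ℝ} (hM : 0 ≤ M)
    (hapr : ∀ w μ, ‖WithLp.toLp 2 (S₀ w, μ)‖ ≤ M * ‖B (WithLp.toLp 2 (w, μ))‖) :
    ∃ Binv : WithLp 2 (H × 𝕜) →L[𝕜] WithLp 2 (H × 𝕜),
      (∀ x, B (Binv x) = x) ∧ (∀ x, Binv (B x) = x) ∧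
      ∃ S : WithLp 2 (H × 𝕜) →L[𝕜] WithLp 2 (H × 𝕜), ‖S‖ ≤ M ∧
        ∀ x, S x = WithLp.toLp 2 (S₀ (Binv x).fst, (Binv x).snd) := by
  have hK : IsCompactOperator ((-c) • S₀ : H →L[𝕜] H) := hS₀c.smul (-c)
  refine bordered_inverse_of_apriori ((1 : H →L[𝕜] H) - T) ((-c) • S₀) S₀ hT hK hS₀ v
    ((innerSL 𝕜 v) ∘L S₀) B (fun w μ => ?_) hM hapr
  rw [hB, neg_smul, ← sub_eq_add_neg]
  rfl

end Bordered

end Summit.NavierStokesRegularity.FluidComputer.BorderedResolventFredholm
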